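import Mathlib
import Literature.MathematicalPhysics.QuantumFieldTheory.Balaban1983to89.B12CondIIIJ

/-!
# `Balaban1983to89.B12ExpSteps` — T. Bałaban, *Renormalization group approach to lattice gauge field theories. I.
Generation of effective actions in a small field approximation and a coupling constant renormalization in four
dimensions*, Commun. Math. Phys. **109**, 249–301 (1987) [Balaban1987RG1], **§3 p. 278 [PDF 30]: the two
EXPONENTIAL-ARITHMETIC steps of the displays (3.41) and (3.43)** — a NEW satellite leaf of
`…Balaban1983to89.B12CondIIIJ` (the displayed first-order ladder (3.41) → (3.44) → (3.46) → (3.47), whose `ineq344` takes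
the CONCLUSIONS of (3.41) and (3.43) as its hypotheses `h41`, `h43`); it imports that module only (hence
`…B12Sec2to5`: `Lemma4Consts`, `Lemma4Restrictions`) and modifies nothing.

CITATION HEADER (lean-in-tree rule 2026-08-18; PDF held `paper:balaban1987-cmp109-rg-i-small-field`, PDF page = journal
page − 248; renders `b2b-balaban-ref1/pages/1987-cmp109-rg-I-small-field/1987-cmp109-rg-I-small-field-pNNN-x2.png`,
NNN = 029, 030, 031, re-read as images by the typing unit `b2b-balaban-b12-g14`).  THE PRINTED LOCI, verbatim:
* p. 277 [29]: *"|𝐇_j(□₀, τQ(…))|, |∇^ξ𝐇_j(□₀, τQ(…))| < B₃²O(1)Mα₀L^{j−1}η on □̃³, |u_j − 1| < B₃²O(1)Mα₀. (3.37)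
  Assume now that B₃²O(1)Mα₀ < 1/2α₁, then the orbit of the configuration U_j(□₀, …) above contains the
  configuration exp iξ𝐇_j(…) satisfying the conditions (i), (ii) on the cube □̃³, hence on X."*
* p. 278 [30]: *"The assumption that the configuration 𝐔 belongs to the space U′ᶜ_{k+1}(□₀, (1+2β)α₀, (1+β)α₁, α₀)
  implies in particular the inequalities |∂U_{k+1}(□₀, M˙(𝐔)) − 1| < (1+2β)α₀(L⁻¹η)², |J_{k+1}(□₀, M˙(𝐔))| < (1+2β)α₀
  on □̃³. (3.40) The first inequality, and the identities (3.39), (3.37) imply |∂ exp iξ𝐇_j(□₀, Q(L⁻¹η𝐇_{k+1})) − 1|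
  = |R((vū_{k+1}v_ju_j)⁻¹)(∂U_{k+1}(□₀, M˙(𝐔)) − 1)| < exp B₃²O(1)Mα₀ exp B₃O(1)Mα₀ exp B₃O(1)Mα₀ × exp O(1)Mα₁
  (1+2β)α₀(L⁻¹η)² < (1+3β)α₀(L^{j−1}η)²ξ² on □̃³, (3.41) for α₁ sufficiently small, e.g. O(1)Mα₁ ≦ β."*;
  *"From the bounds in (3.37), and an elementary inequality, we get |∂ exp iξ𝐇_j(…) − 1 − iξ²(∂^ξ𝐇_j(…))| ≦
  ½(∂|𝐇_j(…)|)²ξ² exp ∂ξ|𝐇_j(…)| < 8(B₃²O(1)Mα₀L^{j−1}η)²ξ² exp 4B₃²O(1)Mα₀L⁻¹η < (4B₃²O(1)M)²α₀²(L^{j−1}η)²ξ² on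
  □̃³. (3.43) We assume that (4B₃²O(1)M)²α₀ ≦ β. This second restriction is not essentially stronger than the first
  one, because we have already assumed the restriction"* — p. 279 [31]: *"O(1)Mα₁ ≦ β on α₁. The above inequality and
  (3.41) yield |∂^ξ𝐇_j(□₀, Q(L⁻¹η𝐇_{k+1}))| < (1+4β)α₀(L^{j−1}η)² on □̃³. (3.44)"*; *"Let us notice that j ≦ k, hence
  L^jη ≦ 1 and (1+7β)L⁻² ≦ 1 for β not too large. The above inequality is the required first inequality in the
  condition (iii)."*

WHAT IS CHECKED HERE.  The census certified these two displays BY HAND only: GAPS C-B12s-3 (`b2b-balaban-b03`) *"(3.41)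
e^{c(B₃²+2B₃)Mα₀+cMα₁}(1+2β) ≤ 1+3β under H-ord.5/6 ✓ (for suitable absolute O(1)'s), (3.43) 8X²e^{4X} ≤ (4X)²·… ✓"* and
GAPS C-adv9-4 (`b2b-balaban-adv9`) *"the printed "e.g. O(1)Mα₁ ≤ β" is literally insufficient, e^β(1+2β) ≥ 1+3β+2β² >
1+3β; it holds with O(1)Mα₁ ≤ β/2 (and H-ord.5 makes the α₀-factors ≤ 1+β/(16B₃²O(1)M)); no consequence, the slack is
absorbed by renaming O(1)"*.  This leaf makes the arithmetic KERNEL facts and QUANTIFIES the located imprecision: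
(§2) the constant step of (3.41), e^a(1+2β) ≤ 1+3β, holds whenever the total exponent a satisfies a(1+3β) ≤ β (no
logarithms: e^a(1−a) ≤ 1), hence for a ≤ β/4 on the typed range β ≤ 1 and for a ≤ β/2 when β ≤ 1/3; the print's
"e.g." read with ONE constant fails for EVERY β > 0 (adv9's caveat, kernel); adv9's "β/2" is RANGE-LIMITED — it fails at
the admissible β = 1/2 (2e^{1/4} > 5/2; numerically the threshold is β* ≈ 0.4027 < β₀ < 1); and the typed print-literal
list `B12Sec2to5.Lemma4Restrictions` (one `O₁` for every "O(1)", conj. 11 = *"O(1)Mα₁ ≤ β"*) admits constants — even with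
B₃ ≥ 1, B₃²O₁M ≥ 1 — at which the constant step is REVERSED (`lemma4Restrictions_not_sufficient_341`), so a kernel
derivation of (3.41) needs a STRONGER α₁-restriction, here 16·O₁Mα₁ ≤ β (§3: the α₀-part of the exponent is ≤ 3β/16 under
the printed *"(4B₃²O(1)M)²α₀ ≤ β"*); (§5) the exponential factor of (3.43), exp 4B₃²O(1)Mα₀L⁻¹η, is < 2 from the typed
restrictions ALONE ((4B₃²O₁M)²α₀ ≤ β ≤ 1 and 1+8β ≤ L² give βL⁻¹ ≤ 1/3, e^{1/3} ≤ 5/3; needs 4B₃²O₁M ≥ 1) — no new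
smallness; (§6) composition with `B12CondIIIJ.ineq344 / ineq345_inner / ineq346 / ineq344τ / ineq347 / ineq347_closes`:
(3.44) and the first inequality of condition (iii) at B′ = 0, every τ ∈ [0,1], from the ANALYTIC inputs as hypotheses
(the first "<" of (3.41); the "elementary inequality" of (3.43) with the (3.37) sums; the (3.45)-type second-order
bounds; triangle inequalities) plus `Lemma4Restrictions` and three unlisted constant hypotheses (B₃ ≥ 1, B₃²O₁M ≥ 1,
16·O₁Mα₁ ≤ β).  All of this is harmless for Lemma 4, which is stated *"for α₀, α₁, α₂, α₃ sufficiently small"*: it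
locates an imprecise "e.g." and records which hypothesis list a kernel needs.
SCHEMATIC TYPING (DIVERGENCE D-b03.1 / D-b12g13.1 / D-b12g14.1): plaquette variables, norms and gauge factors are real
numbers; x := L^{j−1}η and ξ·x = L⁻¹η (ξ = L^{−j}; the display's (L⁻¹η)² = (L^{j−1}η)²ξ²) is a hypothesis `hξx`; in
`ineq341`/`ineq343` the common factor ξ² is cancelled exactly as in `B12CondIIIJ` (T₄₁ = ξ⁻²|∂e^{iξ𝐇} − 1|, T₄₃ = ξ⁻²|∂e^{iξ𝐇} −
1 − iξ²∂^ξ𝐇|); `ineq341_printed` keeps ξ explicit.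
ABSOLUTE RULE.  Nothing of the series is asserted: every displayed bound and every analytic input enters ONLY as a
hypothesis of a kernel-checked real-arithmetic theorem; no `def … : Prop` is introduced.  `[cite: …]` tags mark a PRINTED
display whose arithmetic the theorem checks; `[folklore]` tags mark elementary arithmetic / facts about the typed
hypothesis lists — each docstring says which.  NOT summit progress: two constant-arithmetic steps of the small-field
analytic-extension lemma of one paper of the programme; nothing about Theorem 2's flow, the infinite volume or the Clay
problem.
-/

namespace Literature.MathematicalPhysics.QuantumFieldTheory.Balaban1983to89.B12ExpSteps

open Literature.MathematicalPhysics.QuantumFieldTheory.Balaban1983to89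

/-! ## §1  Elementary exponential arithmetic (Mathlib: `Real.add_one_le_exp`, `Real.add_one_lt_exp`,
`Real.abs_exp_sub_one_le`) -/

/-- e^{1/3} ≤ 5/3 (`Real.abs_exp_sub_one_le`: |x| ≤ 1 ⇒ |eˣ − 1| ≤ 2|x|). [folklore] -/
theorem exp_third_le : Real.exp (1 / 3) ≤ 5 / 3 := by
  have habs : |(1 : ℝ) / 3| = 1 / 3 := abs_of_pos (by norm_num)
  have h := Real.abs_exp_sub_one_le (x := (1 : ℝ) / 3) (by rw [habs]; norm_num)
  rw [habs] at h
  have h2 : Real.exp (1 / 3) - 1 ≤ 2 * (1 / 3) := le_trans (le_abs_self _) h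
  linarith

/-- On 0 ≤ β ≤ 1 a quarter of β is below the threshold of `step341`: 4a ≤ β ⇒ a(1+3β) ≤ β
(β − a(1+3β) = (β − 4a)(1+3β)/4 + 3β(1−β)/4). [folklore] -/
theorem small_of_quarter {a β : ℝ} (hβ : 0 ≤ β) (hβ1 : β ≤ 1) (ha : 4 * a ≤ β) : a * (1 + 3 * β) ≤ β := by
  have h1 : 0 ≤ (β - 4 * a) * (1 + 3 * β) := mul_nonneg (by linarith) (by linarith)
  have h2 : 0 ≤ β * (1 - β) := mul_nonneg hβ (by linarith)
  nlinarith

/-- For β ≤ 1/3 a half of β is below the threshold of `step341`: 2a ≤ β ⇒ a(1+3β) ≤ β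
(β − a(1+3β) = (β − 2a)(1+3β)/2 + β(1−3β)/2). [folklore] -/
theorem small_of_half {a β : ℝ} (hβ : 0 ≤ β) (hβ3 : 3 * β ≤ 1) (ha : 2 * a ≤ β) : a * (1 + 3 * β) ≤ β := by
  have h1 : 0 ≤ (β - 2 * a) * (1 + 3 * β) := mul_nonneg (by linarith) (by linarith)
  have h2 : 0 ≤ β * (1 - 3 * β) := mul_nonneg hβ (by linarith)
  nlinarith

/-! ## §2  The constant step of (3.41): exp(…)·(1+2β) ≤ 1+3β — sufficient conditions and negative certificates -/

/-- **(3.41), last inequality — the constant step.**  If the total exponent a of the four printed factors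
exp B₃²O(1)Mα₀ · exp B₃O(1)Mα₀ · exp B₃O(1)Mα₀ · exp O(1)Mα₁ satisfies a(1+3β) ≤ β (β ≥ 0), then e^a(1+2β) ≤ 1+3β.
(The exact threshold is a ≤ log((1+3β)/(1+2β)); a(1+3β) ≤ β, i.e. a ≤ 1 − (1+2β)/(1+3β), is the log-free sufficient
form: e^a(1+2β) ≤ e^a(1+3β)(1−a) ≤ 1+3β, since e^a(1 − a) ≤ e^a·e^{−a} = 1 for every real a.)  This is the arithmetic
of the printed step *"< (1+3β)α₀(L^{j−1}η)²ξ² … for α₁ sufficiently small"*. [cite: Balaban1987RG1, (3.41) p.278 — last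
inequality] -/
theorem step341 {a β : ℝ} (hβ : 0 ≤ β) (ha : a * (1 + 3 * β) ≤ β) :
    Real.exp a * (1 + 2 * β) ≤ 1 + 3 * β := by
  have h0 : (1 + 3 * β) * (1 - a) = 1 + 3 * β - a * (1 + 3 * β) := by ring
  have h1 : 1 + 2 * β ≤ (1 + 3 * β) * (1 - a) := by
    rw [h0]
    linarith
  have h2 : Real.exp a * (1 - a) ≤ 1 := by
    have h1' : 1 - a ≤ Real.exp (-a) := by
      have := Real.add_one_le_exp (-a)
      linarith
    have h2' : Real.exp a * Real.exp (-a) = 1 := by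
      rw [← Real.exp_add, add_neg_cancel, Real.exp_zero]
    calc Real.exp a * (1 - a) ≤ Real.exp a * Real.exp (-a) := mul_le_mul_of_nonneg_left h1' (Real.exp_pos a).le
      _ = 1 := h2'
  have h3 : 0 ≤ 1 + 3 * β := by linarith
  calc Real.exp a * (1 + 2 * β) ≤ Real.exp a * ((1 + 3 * β) * (1 - a)) :=
        mul_le_mul_of_nonneg_left h1 (Real.exp_pos a).le
    _ = (1 + 3 * β) * (Real.exp a * (1 - a)) := by ring
    _ ≤ (1 + 3 * β) * 1 := mul_le_mul_of_nonneg_left h2 h3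
    _ = 1 + 3 * β := mul_one _

/-- On the typed range (`B12Sec2to5.Lemma4Restrictions`: 0 < β ≤ β₀ < 1) a QUARTER suffices uniformly: a ≤ β/4 ⇒
e^a(1+2β) ≤ 1+3β (numerically a ≤ β/4 works up to β ≈ 1.21). [folklore] -/
theorem step341_quarter {a β : ℝ} (hβ : 0 ≤ β) (hβ1 : β ≤ 1) (ha : 4 * a ≤ β) :
    Real.exp a * (1 + 2 * β) ≤ 1 + 3 * β :=
  step341 hβ (small_of_quarter hβ hβ1 ha)

/-- adv9's constant (GAPS C-adv9-4: *"it holds with O(1)Mα₁ ≤ β/2"*) in the range where it IS valid: a ≤ β/2 suffices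
when β ≤ 1/3. [folklore] -/
theorem step341_half {a β : ℝ} (hβ : 0 ≤ β) (hβ3 : 3 * β ≤ 1) (ha : 2 * a ≤ β) :
    Real.exp a * (1 + 2 * β) ≤ 1 + 3 * β :=
  step341 hβ (small_of_half hβ hβ3 ha)

/-- **Negative certificate 1 (the print's "e.g.", read with ONE constant).**  *"for α₁ sufficiently small, e.g.
O(1)Mα₁ ≤ β"* with the O(1) of the factor exp O(1)Mα₁ does NOT give the last inequality of (3.41): already the
α₁-factor alone at equality O(1)Mα₁ = β exceeds the target for EVERY β > 0, e^β(1+2β) ≥ (1+β)(1+2β) = 1+3β+2β² > 1+3β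
(GAPS C-adv9-4's caveat, now kernel-checked).  Harmless for Lemma 4 (*"sufficiently small"*); it locates an imprecise
"e.g.". [cite: Balaban1987RG1, (3.41) p.278 — "e.g. O(1)Mα₁ ≤ β"] -/
theorem step341_eg_insufficient {β : ℝ} (hβ : 0 < β) : 1 + 3 * β < Real.exp β * (1 + 2 * β) := by
  have h1 : β + 1 ≤ Real.exp β := Real.add_one_le_exp β
  have h2 : 0 ≤ 1 + 2 * β := by linarith
  have h3 : (β + 1) * (1 + 2 * β) ≤ Real.exp β * (1 + 2 * β) := mul_le_mul_of_nonneg_right h1 h2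
  nlinarith [mul_pos hβ hβ]

/-- **Negative certificate 2 (adv9's uniform "β/2" is range-limited).**  At the admissible β = 1/2 (the typed list allows
every 0 < β ≤ β₀ < 1) the α₁-factor alone at equality O(1)Mα₁ = β/2 = 1/4 already gives 2e^{1/4} > 2·(5/4) = 5/2 = 1+3β.
(Numerically e^{β/2}(1+2β) ≤ 1+3β iff β ≤ β* ≈ 0.4027; `step341_half` certifies the range β ≤ 1/3.) [folklore] -/
theorem step341_half_insufficient :
    (1 : ℝ) + 3 * (1 / 2) < Real.exp ((1 / 2) / 2) * (1 + 2 * (1 / 2)) := by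
  have h : (1 / 2 : ℝ) / 2 + 1 < Real.exp ((1 / 2) / 2) := Real.add_one_lt_exp (by norm_num)
  norm_num at h ⊢
  linarith

/-- **Negative certificate 3 (the typed print-literal restriction list does not deliver (3.41)).**
`B12Sec2to5.Lemma4Restrictions` records the print's *"O(1)Mα₁ ≤ β"* (conj. 11) and *"(4B₃²O(1)M)²α₀ ≤ β"* (conj. 10)
with ONE constant `O₁` for every "O(1)" of (3.37)–(3.43); under it — even with B₃ ≥ 1 and B₃²O₁M ≥ 1 — the constant step
of (3.41) can be REVERSED: witness B₃ = O₁ = M = 1, L = 3, β₀ = 9/10, β = α₁ = 1/2, α₀ = 1/32, α₂ = 1, α₃ = 1/2000, where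
the four factors give e^{19/32}·2 ≥ (51/32)·2 > 5/2 = 1+3β.  So a kernel proof of (3.41) from the typed list needs a
STRONGER α₁-restriction (§3–§4: 16·O₁Mα₁ ≤ β) — the located imprecision of the print's "e.g.", quantified; of no
consequence for Lemma 4. [folklore] -/
theorem lemma4Restrictions_not_sufficient_341 :
    ∃ c : B12Sec2to5.Lemma4Consts, B12Sec2to5.Lemma4Restrictions c ∧ 1 ≤ c.B₃ ∧ 1 ≤ c.B₃ ^ 2 * c.O₁ * c.M ∧
      1 + 3 * c.β < Real.exp (c.B₃ ^ 2 * c.O₁ * c.M * c.α₀) * Real.exp (c.B₃ * c.O₁ * c.M * c.α₀) *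
        Real.exp (c.B₃ * c.O₁ * c.M * c.α₀) * Real.exp (c.O₁ * c.M * c.α₁) * (1 + 2 * c.β) := by
  refine ⟨⟨1, 1, 1, 3, 9 / 10, 1 / 2, 1 / 32, 1 / 2, 1, 1 / 2000⟩, ?_, ?_, ?_, ?_⟩
  · unfold B12Sec2to5.Lemma4Restrictions
    norm_num
  · show (1 : ℝ) ≤ 1
    norm_num
  · show (1 : ℝ) ≤ 1 ^ 2 * 1 * 1
    norm_num
  · show 1 + 3 * (1 / 2 : ℝ) < Real.exp ((1 : ℝ) ^ 2 * 1 * 1 * (1 / 32)) * Real.exp (1 * 1 * 1 * (1 / 32)) *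
        Real.exp (1 * 1 * 1 * (1 / 32)) * Real.exp (1 * 1 * (1 / 2)) * (1 + 2 * (1 / 2))
    rw [← Real.exp_add, ← Real.exp_add, ← Real.exp_add]
    have h := Real.add_one_le_exp
      ((1 : ℝ) ^ 2 * 1 * 1 * (1 / 32) + 1 * 1 * 1 * (1 / 32) + 1 * 1 * 1 * (1 / 32) + 1 * 1 * (1 / 2))
    norm_num at h ⊢
    linarith

/-- The REPAIRED hypothesis set used below (typed list + B₃ ≥ 1 + B₃²O₁M ≥ 1 + 16·O₁Mα₁ ≤ β) is jointly satisfiable: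
B₃ = O₁ = M = 1, L = 3, β₀ = 9/10, β = 1/2, α₀ = 1/128, α₁ = 1/32, α₂ = 1, α₃ = 1/10000.  Consistency of a hypothesis
list, no content of the series. [folklore] -/
theorem repaired_restrictions_satisfiable :
    ∃ c : B12Sec2to5.Lemma4Consts, B12Sec2to5.Lemma4Restrictions c ∧ 1 ≤ c.B₃ ∧ 1 ≤ c.B₃ ^ 2 * c.O₁ * c.M ∧
      16 * (c.O₁ * c.M * c.α₁) ≤ c.β := by
  refine ⟨⟨1, 1, 1, 3, 9 / 10, 1 / 2, 1 / 128, 1 / 32, 1, 1 / 10000⟩, ?_, ?_, ?_, ?_⟩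
  · unfold B12Sec2to5.Lemma4Restrictions
    norm_num
  · show (1 : ℝ) ≤ 1
    norm_num
  · show (1 : ℝ) ≤ 1 ^ 2 * 1 * 1
    norm_num
  · show 16 * (1 * 1 * (1 / 32 : ℝ)) ≤ 1 / 2
    norm_num

/-! ## §3  The exponent of (3.41) under the PRINTED α₀-restriction and a STRENGTHENED α₁-restriction -/

/-- The α₀-part of the exponent under the printed *"(4B₃²O(1)M)²α₀ ≤ β"* (typed conj. 10), for B₃ ≥ 1 and B₃²O(1)M ≥ 1:
16·(B₃² + 2B₃)O(1)Mα₀ ≤ 48·B₃²O(1)Mα₀ ≤ 3·(4B₃²O(1)M)²α₀ ≤ 3β, i.e. the α₀-part is ≤ 3β/16 (adv9, GAPS C-adv9-4: *"H-ord.5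
makes the α₀-factors ≤ 1+β/(16B₃²O(1)M)"*). [folklore] -/
theorem alpha0_part_le {B₃ O₁ M α₀ β : ℝ} (hB : 1 ≤ B₃) (hY : 1 ≤ B₃ ^ 2 * O₁ * M) (hα₀ : 0 ≤ α₀)
    (hres : (4 * B₃ ^ 2 * O₁ * M) ^ 2 * α₀ ≤ β) :
    16 * (B₃ ^ 2 * O₁ * M * α₀ + B₃ * O₁ * M * α₀ + B₃ * O₁ * M * α₀) ≤ 3 * β := by
  have hB2 : 0 < B₃ ^ 2 := by positivity
  have hOM : 0 < O₁ * M := by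
    by_contra hneg
    have hle : O₁ * M ≤ 0 := not_lt.mp hneg
    have h' : B₃ ^ 2 * (O₁ * M) ≤ 0 := mul_nonpos_of_nonneg_of_nonpos hB2.le hle
    have h'' : B₃ ^ 2 * O₁ * M = B₃ ^ 2 * (O₁ * M) := by ring
    linarith
  have h1 : B₃ * O₁ * M * α₀ ≤ B₃ ^ 2 * O₁ * M * α₀ := by
    have h' : 0 ≤ B₃ * (B₃ - 1) * (O₁ * M) * α₀ :=
      mul_nonneg (mul_nonneg (mul_nonneg (by linarith) (by linarith)) hOM.le) hα₀
    nlinarith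
  have h2 : 16 * (B₃ ^ 2 * O₁ * M * α₀) ≤ (4 * B₃ ^ 2 * O₁ * M) ^ 2 * α₀ := by
    have h' : 0 ≤ (B₃ ^ 2 * O₁ * M) * (B₃ ^ 2 * O₁ * M - 1) * α₀ :=
      mul_nonneg (mul_nonneg (by linarith) (by linarith)) hα₀
    nlinarith
  linarith

/-- The whole exponent under conj. 10 and the STRENGTHENED α₁-restriction 16·O(1)Mα₁ ≤ β (the print's *"e.g. O(1)Mα₁ ≤
β"* with the constant renamed, adv9: *"the slack is absorbed by renaming O(1)"*): 4a ≤ 3β/4 + β/4 = β. [folklore] -/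
theorem exponent341_le_quarter {B₃ O₁ M α₀ α₁ β : ℝ} (hB : 1 ≤ B₃) (hY : 1 ≤ B₃ ^ 2 * O₁ * M) (hα₀ : 0 ≤ α₀)
    (hres : (4 * B₃ ^ 2 * O₁ * M) ^ 2 * α₀ ≤ β) (hα₁ : 16 * (O₁ * M * α₁) ≤ β) :
    4 * (B₃ ^ 2 * O₁ * M * α₀ + B₃ * O₁ * M * α₀ + B₃ * O₁ * M * α₀ + O₁ * M * α₁) ≤ β := by
  have h := alpha0_part_le hB hY hα₀ hres
  linarith

/-! ## §4  (3.41): the last printed inequality, kernel-checked from the first one -/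

/-- The four printed factors are ONE exponential of the total exponent. [folklore] -/
theorem factors341 (B₃ O₁ M α₀ α₁ : ℝ) :
    Real.exp (B₃ ^ 2 * O₁ * M * α₀) * Real.exp (B₃ * O₁ * M * α₀) * Real.exp (B₃ * O₁ * M * α₀) *
        Real.exp (O₁ * M * α₁) =
      Real.exp (B₃ ^ 2 * O₁ * M * α₀ + B₃ * O₁ * M * α₀ + B₃ * O₁ * M * α₀ + O₁ * M * α₁) := by
  rw [← Real.exp_add, ← Real.exp_add, ← Real.exp_add]

/-- **(3.41), last inequality (ξ² cancelled, as `B12CondIIIJ`).**  Schematic: `T₄₁` = ξ⁻²|∂ exp iξ𝐇_j(□₀, Q(L⁻¹η𝐇_{k+1}))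
− 1|, x = L^{j−1}η (the display's (L⁻¹η)² = x²ξ², ξ = L^{−j}); `h41a` = the FIRST printed inequality of (3.41) (from
(3.39), (3.37), the first inequality of (3.40) and the bound on the rotation R((vū_{k+1}v_ju_j)⁻¹) — ANALYTIC INPUT,
hypothesis), with ξ² cancelled; `hsmall` = the log-free sufficient smallness a(1+3β) ≤ β on the total exponent a (§2;
discharged from restrictions in `ineq341_of_restrictions`).  Conclusion = the hypothesis `h41` of `B12CondIIIJ.ineq344`.
[cite: Balaban1987RG1, (3.41) p.278] -/
theorem ineq341 {β α₀ α₁ B₃ O₁ M x T₄₁ : ℝ} (hβ : 0 ≤ β) (hα₀ : 0 ≤ α₀)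
    (hsmall : (B₃ ^ 2 * O₁ * M * α₀ + B₃ * O₁ * M * α₀ + B₃ * O₁ * M * α₀ + O₁ * M * α₁) * (1 + 3 * β) ≤ β)
    (h41a : T₄₁ < Real.exp (B₃ ^ 2 * O₁ * M * α₀) * Real.exp (B₃ * O₁ * M * α₀) * Real.exp (B₃ * O₁ * M * α₀) *
      Real.exp (O₁ * M * α₁) * ((1 + 2 * β) * α₀ * x ^ 2)) :
    T₄₁ < (1 + 3 * β) * α₀ * x ^ 2 := by
  rw [factors341] at h41a
  have hstep := step341 hβ hsmall
  have hax : 0 ≤ α₀ * x ^ 2 := mul_nonneg hα₀ (sq_nonneg x)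
  set a := B₃ ^ 2 * O₁ * M * α₀ + B₃ * O₁ * M * α₀ + B₃ * O₁ * M * α₀ + O₁ * M * α₁ with ha
  calc T₄₁ < Real.exp a * ((1 + 2 * β) * α₀ * x ^ 2) := h41a
    _ = (Real.exp a * (1 + 2 * β)) * (α₀ * x ^ 2) := by ring
    _ ≤ (1 + 3 * β) * (α₀ * x ^ 2) := mul_le_mul_of_nonneg_right hstep hax
    _ = (1 + 3 * β) * α₀ * x ^ 2 := by ring

/-- **(3.41) with ξ explicit, both members as printed**: the first printed bound is in the scale (L⁻¹η)², the last in
(L^{j−1}η)²ξ²; with ξ·x = L⁻¹η (x = L^{j−1}η, ξ = L^{−j}) they agree and the constant step gives the printed *"<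
(1+3β)α₀(L^{j−1}η)²ξ²"*.  Here `T` = |∂ exp iξ𝐇_j(…) − 1| itself. [cite: Balaban1987RG1, (3.41) p.278] -/
theorem ineq341_printed {β α₀ α₁ B₃ O₁ M L η ξ x T : ℝ} (hβ : 0 ≤ β) (hα₀ : 0 ≤ α₀) (hξx : ξ * x = L⁻¹ * η)
    (hsmall : (B₃ ^ 2 * O₁ * M * α₀ + B₃ * O₁ * M * α₀ + B₃ * O₁ * M * α₀ + O₁ * M * α₁) * (1 + 3 * β) ≤ β)
    (h41a : T < Real.exp (B₃ ^ 2 * O₁ * M * α₀) * Real.exp (B₃ * O₁ * M * α₀) * Real.exp (B₃ * O₁ * M * α₀) *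
      Real.exp (O₁ * M * α₁) * ((1 + 2 * β) * α₀ * (L⁻¹ * η) ^ 2)) :
    T < (1 + 3 * β) * α₀ * x ^ 2 * ξ ^ 2 := by
  rw [factors341] at h41a
  have hstep := step341 hβ hsmall
  have hsq : (L⁻¹ * η) ^ 2 = ξ ^ 2 * x ^ 2 := by rw [← hξx]; ring
  have hax : 0 ≤ α₀ * (ξ ^ 2 * x ^ 2) := mul_nonneg hα₀ (mul_nonneg (sq_nonneg ξ) (sq_nonneg x))
  set a := B₃ ^ 2 * O₁ * M * α₀ + B₃ * O₁ * M * α₀ + B₃ * O₁ * M * α₀ + O₁ * M * α₁ with ha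
  calc T < Real.exp a * ((1 + 2 * β) * α₀ * (L⁻¹ * η) ^ 2) := h41a
    _ = (Real.exp a * (1 + 2 * β)) * (α₀ * (ξ ^ 2 * x ^ 2)) := by rw [hsq]; ring
    _ ≤ (1 + 3 * β) * (α₀ * (ξ ^ 2 * x ^ 2)) := mul_le_mul_of_nonneg_right hstep hax
    _ = (1 + 3 * β) * α₀ * x ^ 2 * ξ ^ 2 := by ring

/-- **(3.41) from the restrictions.**  Under `B12Sec2to5.Lemma4Restrictions c` (conj. 10 *"(4B₃²O(1)M)²α₀ ≤ β"*, 0 < β ≤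
β₀ < 1) plus the unlisted B₃ ≥ 1 ([Balaban1985Variational] Prop. 9's "sufficiently large" constant), B₃²O₁M ≥ 1 and the
STRENGTHENED α₁-restriction 16·O₁Mα₁ ≤ β (replacing the print's "e.g. O(1)Mα₁ ≤ β", see `lemma4Restrictions_not_
sufficient_341`), the first printed inequality of (3.41) implies the last one.  [cite: Balaban1987RG1, (3.41) p.278] -/
theorem ineq341_of_restrictions (c : B12Sec2to5.Lemma4Consts) (hR : B12Sec2to5.Lemma4Restrictions c)
    (hB : 1 ≤ c.B₃) (hY : 1 ≤ c.B₃ ^ 2 * c.O₁ * c.M) (hα₁ : 16 * (c.O₁ * c.M * c.α₁) ≤ c.β) {x T₄₁ : ℝ}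
    (h41a : T₄₁ < Real.exp (c.B₃ ^ 2 * c.O₁ * c.M * c.α₀) * Real.exp (c.B₃ * c.O₁ * c.M * c.α₀) *
      Real.exp (c.B₃ * c.O₁ * c.M * c.α₀) * Real.exp (c.O₁ * c.M * c.α₁) * ((1 + 2 * c.β) * c.α₀ * x ^ 2)) :
    T₄₁ < (1 + 3 * c.β) * c.α₀ * x ^ 2 := by
  have hR' := hR
  unfold B12Sec2to5.Lemma4Restrictions at hR'
  obtain ⟨hα₀, _, _, _, hβ, hββ₀, hβ₀, _, _, hres10, _, _, _, _⟩ := hR'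
  have hβ1 : c.β ≤ 1 := by linarith
  have hq := exponent341_le_quarter hB hY hα₀.le hres10 hα₁
  exact ineq341 hβ.le hα₀.le (small_of_quarter hβ.le hβ1 hq) h41a

/-! ## §5  (3.43): the middle and last printed inequalities; the exponential factor is < 2 under the typed restrictions -/

/-- **(3.43): exp 4B₃²O(1)Mα₀L⁻¹η < 2 under the typed restrictions alone.**  With K := 4B₃²O(1)M ≥ 1: Kα₀ ≤ K·Kα₀ =
(4B₃²O(1)M)²α₀ ≤ β; β ≤ 1 and 1 + 8β ≤ L² give (3β)² ≤ 1 + 8β ≤ L², so 3β ≤ L and βL⁻¹ ≤ 1/3; hence for 0 ≤ η ≤ 1 the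
exponent is ≤ 1/3 and e^{1/3} ≤ 5/3 < 2.  NO new smallness assumption is needed for the last inequality of (3.43).
[cite: Balaban1987RG1, (3.43) p.278 — "exp 4B₃²O(1)Mα₀L⁻¹η"] -/
theorem exp343_lt_two {B₃ O₁ M α₀ β L η : ℝ} (hα₀ : 0 ≤ α₀) (hone : 1 ≤ 4 * B₃ ^ 2 * O₁ * M)
    (hres : (4 * B₃ ^ 2 * O₁ * M) ^ 2 * α₀ ≤ β) (hβ1 : β ≤ 1) (hL : 0 < L) (hres8 : 1 + 8 * β ≤ L ^ 2)
    (hη0 : 0 ≤ η) (hη1 : η ≤ 1) :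
    Real.exp (4 * B₃ ^ 2 * O₁ * M * α₀ * (L⁻¹ * η)) < 2 := by
  set K := 4 * B₃ ^ 2 * O₁ * M with hK
  have hK0 : 0 ≤ K := by linarith
  have hX0 : 0 ≤ K * α₀ := mul_nonneg hK0 hα₀
  have hXβ : K * α₀ ≤ β := by
    have h1 : K * α₀ * 1 ≤ K * α₀ * K := mul_le_mul_of_nonneg_left hone hX0
    have h2 : K ^ 2 * α₀ = K * α₀ * K := by ring
    linarith
  have hβ0 : 0 ≤ β := le_trans hX0 hXβ
  have h9 : (3 * β) ^ 2 ≤ L ^ 2 := by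
    have h' : 0 ≤ (9 * β + 1) * (1 - β) := mul_nonneg (by linarith) (by linarith)
    nlinarith
  have h3β : 3 * β ≤ L := by nlinarith
  have hLinv : 0 < L⁻¹ := inv_pos.mpr hL
  have hβL : β * L⁻¹ ≤ 1 / 3 := by
    rw [← div_eq_mul_inv, div_le_iff₀ hL]
    linarith
  have ht : K * α₀ * (L⁻¹ * η) ≤ 1 / 3 := by
    have h1 : L⁻¹ * η ≤ L⁻¹ := by
      calc L⁻¹ * η ≤ L⁻¹ * 1 := mul_le_mul_of_nonneg_left hη1 hLinv.le
        _ = L⁻¹ := mul_one _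
    have h2 : 0 ≤ L⁻¹ * η := mul_nonneg hLinv.le hη0
    calc K * α₀ * (L⁻¹ * η) ≤ β * (L⁻¹ * η) := mul_le_mul_of_nonneg_right hXβ h2
      _ ≤ β * L⁻¹ := mul_le_mul_of_nonneg_left h1 hβ0
      _ ≤ 1 / 3 := hβL
  calc Real.exp (K * α₀ * (L⁻¹ * η)) ≤ Real.exp (1 / 3) := Real.exp_le_exp.mpr ht
    _ ≤ 5 / 3 := exp_third_le
    _ < 2 := by norm_num

/-- The same from `Lemma4Restrictions c` (conj. 1, 6, 7, 8, 10, 14) + B₃²O₁M ≥ 1, at any scale 1 ≤ j with L^jη ≤ 1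
(p. 279 *"j ≤ k, hence L^jη ≤ 1"*; so 0 ≤ η ≤ 1). [folklore] -/
theorem exp343_lt_two_of_restrictions (c : B12Sec2to5.Lemma4Consts) (hR : B12Sec2to5.Lemma4Restrictions c)
    (hY : 1 ≤ c.B₃ ^ 2 * c.O₁ * c.M) {η : ℝ} {j : ℕ} (hη : 0 ≤ η) (hj : 1 ≤ j) (hscale : c.L ^ j * η ≤ 1) :
    Real.exp (4 * c.B₃ ^ 2 * c.O₁ * c.M * c.α₀ * (c.L⁻¹ * η)) < 2 := by
  have _hj := hj
  unfold B12Sec2to5.Lemma4Restrictions at hR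
  obtain ⟨hα₀, _, _, _, _, hββ₀, hβ₀, hL1, _, hres10, _, _, _, hres8⟩ := hR
  have hone : 1 ≤ 4 * c.B₃ ^ 2 * c.O₁ * c.M := by linarith
  have hη1 : η ≤ 1 := by
    have h1 : 1 ≤ c.L ^ j := one_le_pow₀ hL1.le
    have h2 : η ≤ c.L ^ j * η := le_mul_of_one_le_left hη h1
    linarith
  exact exp343_lt_two hα₀.le hone hres10 (by linarith) (by linarith) hres8 hη hη1

/-- **(3.43), middle inequality** *"≦ ½(∂|𝐇_j(…)|)²ξ² exp ∂ξ|𝐇_j(…)| < 8(B₃²O(1)Mα₀L^{j−1}η)²ξ² exp 4B₃²O(1)Mα₀L⁻¹η"*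
(ξ² cancelled): schematic `T₄₃` = ξ⁻²|∂ exp iξ𝐇_j(…) − 1 − iξ²∂^ξ𝐇_j(…)| (as `B12CondIIIJ`), `P` = ∂|𝐇_j(…)| (the sum of
|𝐇_j| over the four boundary bonds of the plaquette), x = L^{j−1}η, `hξx` : ξ·x = L⁻¹η (ξ = L^{−j}); `helem` = the print's
"elementary inequality" (ANALYTIC INPUT, hypothesis); `hP` = (3.37) summed over the four bonds (strict).  Kernel:
P² < (4B₃²O(1)Mα₀x)² and exp ξP ≤ exp 4B₃²O(1)Mα₀(ξx). [cite: Balaban1987RG1, (3.43) p.278 — middle inequality] -/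
theorem ineq343_mid {B₃ O₁ M α₀ L η ξ x P T₄₃ : ℝ} (hξ : 0 ≤ ξ) (hξx : ξ * x = L⁻¹ * η)
    (helem : T₄₃ ≤ 1 / 2 * P ^ 2 * Real.exp (ξ * P)) (hP0 : 0 ≤ P)
    (hP : P < 4 * (B₃ ^ 2 * O₁ * M * α₀ * x)) :
    T₄₃ < 8 * (B₃ ^ 2 * O₁ * M * α₀ * x) ^ 2 * Real.exp (4 * B₃ ^ 2 * O₁ * M * α₀ * (L⁻¹ * η)) := by
  set h := B₃ ^ 2 * O₁ * M * α₀ * x with hh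
  have hE : ξ * P ≤ 4 * B₃ ^ 2 * O₁ * M * α₀ * (L⁻¹ * η) := by
    have h1 : ξ * P ≤ ξ * (4 * h) := mul_le_mul_of_nonneg_left hP.le hξ
    have h2 : ξ * (4 * h) = 4 * B₃ ^ 2 * O₁ * M * α₀ * (ξ * x) := by rw [hh]; ring
    rw [h2, hξx] at h1
    exact h1
  have hexp : Real.exp (ξ * P) ≤ Real.exp (4 * B₃ ^ 2 * O₁ * M * α₀ * (L⁻¹ * η)) := Real.exp_le_exp.mpr hE
  have hP2 : P ^ 2 < (4 * h) ^ 2 := by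
    nlinarith [mul_pos (sub_pos.2 hP) (by linarith : 0 < 4 * h + P)]
  have hE0 : 0 < Real.exp (ξ * P) := Real.exp_pos _
  calc T₄₃ ≤ 1 / 2 * P ^ 2 * Real.exp (ξ * P) := helem
    _ < 1 / 2 * (4 * h) ^ 2 * Real.exp (ξ * P) := by
        apply mul_lt_mul_of_pos_right _ hE0
        linarith
    _ ≤ 1 / 2 * (4 * h) ^ 2 * Real.exp (4 * B₃ ^ 2 * O₁ * M * α₀ * (L⁻¹ * η)) :=
        mul_le_mul_of_nonneg_left hexp (by positivity)
    _ = 8 * h ^ 2 * Real.exp (4 * B₃ ^ 2 * O₁ * M * α₀ * (L⁻¹ * η)) := by ring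

/-- **(3.43), last inequality** *"< (4B₃²O(1)M)²α₀²(L^{j−1}η)²ξ²"* (ξ² cancelled): 8h²·E < 16h² as soon as the
exponential factor E is < 2 (`exp343_lt_two`) and h = B₃²O(1)Mα₀x ≠ 0. [cite: Balaban1987RG1, (3.43) p.278 — last
inequality] -/
theorem ineq343_last {B₃ O₁ M α₀ x E : ℝ} (hh : 0 < B₃ ^ 2 * O₁ * M * α₀ * x) (hE : E < 2) :
    8 * (B₃ ^ 2 * O₁ * M * α₀ * x) ^ 2 * E < (4 * B₃ ^ 2 * O₁ * M) ^ 2 * α₀ ^ 2 * x ^ 2 := by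
  have h2 : 0 < 8 * (B₃ ^ 2 * O₁ * M * α₀ * x) ^ 2 := by positivity
  calc 8 * (B₃ ^ 2 * O₁ * M * α₀ * x) ^ 2 * E < 8 * (B₃ ^ 2 * O₁ * M * α₀ * x) ^ 2 * 2 :=
        mul_lt_mul_of_pos_left hE h2
    _ = (4 * B₃ ^ 2 * O₁ * M) ^ 2 * α₀ ^ 2 * x ^ 2 := by ring

/-- **(3.43), middle + last** ⇒ the hypothesis `h43` of `B12CondIIIJ.ineq344`: T₄₃ < (4B₃²O(1)M)²α₀²x², from the
elementary inequality, the (3.37) sums and exp 4B₃²O(1)Mα₀L⁻¹η < 2. [cite: Balaban1987RG1, (3.43) p.278] -/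
theorem ineq343 {B₃ O₁ M α₀ L η ξ x P T₄₃ : ℝ} (hξ : 0 ≤ ξ) (hξx : ξ * x = L⁻¹ * η)
    (helem : T₄₃ ≤ 1 / 2 * P ^ 2 * Real.exp (ξ * P)) (hP0 : 0 ≤ P)
    (hP : P < 4 * (B₃ ^ 2 * O₁ * M * α₀ * x))
    (hexp : Real.exp (4 * B₃ ^ 2 * O₁ * M * α₀ * (L⁻¹ * η)) < 2) :
    T₄₃ < (4 * B₃ ^ 2 * O₁ * M) ^ 2 * α₀ ^ 2 * x ^ 2 := by
  have hh : 0 < B₃ ^ 2 * O₁ * M * α₀ * x := by linarith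
  exact lt_trans (ineq343_mid hξ hξx helem hP0 hP) (ineq343_last hh hexp)

/-! ## §6  Composition with `B12CondIIIJ`: (3.44) and the first inequality of (iii) (B′ = 0) from the analytic inputs -/

/-- **(3.44) from the analytic inputs.**  Under `Lemma4Restrictions c` + B₃ ≥ 1 + B₃²O₁M ≥ 1 + 16·O₁Mα₁ ≤ β, at any scale
1 ≤ j with L^jη ≤ 1 and with ξ·L^{j−1}η = L⁻¹η: the first "<" of (3.41) (`h41a`), the elementary inequality of (3.43) with
the (3.37) sums (`helem`, `hP`) and the triangle inequality ξ²|∂^ξ𝐇| ≤ |∂e^{iξ𝐇} − 1| + |∂e^{iξ𝐇} − 1 − iξ²∂^ξ𝐇| (`htri`)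
give the printed (3.44) *"|∂^ξ𝐇_j(□₀, Q(L⁻¹η𝐇_{k+1}))| < (1+4β)α₀(L^{j−1}η)²"* — every constant-arithmetic step kernel-
checked (`ineq341_of_restrictions`, `ineq343`, `exp343_lt_two_of_restrictions`, `B12CondIIIJ.ineq344`).
[cite: Balaban1987RG1, (3.41)–(3.44) pp.278–279] -/
theorem ineq344_of_inputs (c : B12Sec2to5.Lemma4Consts) (hR : B12Sec2to5.Lemma4Restrictions c)
    (hB : 1 ≤ c.B₃) (hY : 1 ≤ c.B₃ ^ 2 * c.O₁ * c.M) (hα₁ : 16 * (c.O₁ * c.M * c.α₁) ≤ c.β)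
    {η ξ P T₄₁ T₄₃ D : ℝ} {j : ℕ} (hη : 0 ≤ η) (hj : 1 ≤ j) (hscale : c.L ^ j * η ≤ 1)
    (hξ : 0 ≤ ξ) (hξx : ξ * (c.L ^ (j - 1) * η) = c.L⁻¹ * η)
    (h41a : T₄₁ < Real.exp (c.B₃ ^ 2 * c.O₁ * c.M * c.α₀) * Real.exp (c.B₃ * c.O₁ * c.M * c.α₀) *
      Real.exp (c.B₃ * c.O₁ * c.M * c.α₀) * Real.exp (c.O₁ * c.M * c.α₁) *
      ((1 + 2 * c.β) * c.α₀ * (c.L ^ (j - 1) * η) ^ 2))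
    (helem : T₄₃ ≤ 1 / 2 * P ^ 2 * Real.exp (ξ * P)) (hP0 : 0 ≤ P)
    (hP : P < 4 * (c.B₃ ^ 2 * c.O₁ * c.M * c.α₀ * (c.L ^ (j - 1) * η)))
    (htri : D ≤ T₄₁ + T₄₃) :
    D < (1 + 4 * c.β) * c.α₀ * (c.L ^ (j - 1) * η) ^ 2 := by
  have hR' := hR
  unfold B12Sec2to5.Lemma4Restrictions at hR'
  obtain ⟨hα₀, _, _, _, _, _, _, _, _, hres10, _, _, _, _⟩ := hR'
  exact B12CondIIIJ.ineq344 hα₀.le hres10 htri (ineq341_of_restrictions c hR hB hY hα₁ h41a)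
    (ineq343 hξ hξx helem hP0 hP (exp343_lt_two_of_restrictions c hR hY hη hj hscale))

/-- **The first inequality of condition (iii) (p. 262 (1.14): |∂𝐔 − 1| < α₀ξ²) for the composite configuration at
B′ = 0, every τ ∈ [0, 1], FROM THE ANALYTIC INPUTS**: the first "<" of (3.41); the elementary inequality of (3.43) with the
(3.37) sums at Q(…) and at τQ(…) ((3.37) is uniform in τ); the (3.45)-type second-order bounds *"< B₃(B₃O(1)Mα₀L^{j−1}η)²"*
([Balaban1985Variational] (174)–(177)) at Q and at τQ; the triangle inequalities the text leaves implicit — plus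
`Lemma4Restrictions c` and the three unlisted constant hypotheses (B₃ ≥ 1, B₃²O₁M ≥ 1, 16·O₁Mα₁ ≤ β).  Chain: (3.44)
`ineq344_of_inputs` → (3.45) `B12CondIIIJ.ineq345_inner` → (3.46) `ineq346` → (1+6β) `ineq344τ` → (3.47) `ineq347` (with
the (3.43)-remainder at τQ, `ineq343`) → *"(1+7β)L⁻² ≤ 1"* `ineq347_closes` (1 + 7β ≤ 1 + 8β ≤ L²).  Schematic reals
(`E` = ξ⁻²|∂ exp iξ𝐇_j(□₀, τQ(…)) − 1|); p. 279 *"The above inequality is the required first inequality in the condition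
(iii)"* with its inputs explicit. [folklore] -/
theorem condIII_first_of_inputs (c : B12Sec2to5.Lemma4Consts) (hR : B12Sec2to5.Lemma4Restrictions c)
    (hB : 1 ≤ c.B₃) (hY : 1 ≤ c.B₃ ^ 2 * c.O₁ * c.M) (hα₁ : 16 * (c.O₁ * c.M * c.α₁) ≤ c.β)
    {η ξ τ P Pτ T₄₁ T₄₃ T₄₃τ D T₄₅ D₁ Tτ Dτ E : ℝ} {j : ℕ}
    (hη : 0 ≤ η) (hj : 1 ≤ j) (hscale : c.L ^ j * η ≤ 1)
    (hξ : 0 ≤ ξ) (hξx : ξ * (c.L ^ (j - 1) * η) = c.L⁻¹ * η)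
    (h41a : T₄₁ < Real.exp (c.B₃ ^ 2 * c.O₁ * c.M * c.α₀) * Real.exp (c.B₃ * c.O₁ * c.M * c.α₀) *
      Real.exp (c.B₃ * c.O₁ * c.M * c.α₀) * Real.exp (c.O₁ * c.M * c.α₁) *
      ((1 + 2 * c.β) * c.α₀ * (c.L ^ (j - 1) * η) ^ 2))
    (helem : T₄₃ ≤ 1 / 2 * P ^ 2 * Real.exp (ξ * P)) (hP0 : 0 ≤ P)
    (hP : P < 4 * (c.B₃ ^ 2 * c.O₁ * c.M * c.α₀ * (c.L ^ (j - 1) * η)))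
    (htri₁ : D ≤ T₄₁ + T₄₃)
    (h45a : T₄₅ < c.B₃ * (c.B₃ * c.O₁ * c.M * c.α₀ * (c.L ^ (j - 1) * η)) ^ 2) (htri₂ : D₁ ≤ D + T₄₅)
    (hτ0 : 0 ≤ τ) (hτ1 : τ ≤ 1) (hD₁ : 0 ≤ D₁)
    (h45τa : Tτ < c.B₃ * (c.B₃ * c.O₁ * c.M * c.α₀ * (c.L ^ (j - 1) * η)) ^ 2) (htri₃ : Dτ ≤ τ * D₁ + Tτ)
    (helemτ : T₄₃τ ≤ 1 / 2 * Pτ ^ 2 * Real.exp (ξ * Pτ)) (hPτ0 : 0 ≤ Pτ)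
    (hPτ : Pτ < 4 * (c.B₃ ^ 2 * c.O₁ * c.M * c.α₀ * (c.L ^ (j - 1) * η)))
    (htri₄ : E ≤ Dτ + T₄₃τ) :
    E < c.α₀ := by
  have hR' := hR
  unfold B12Sec2to5.Lemma4Restrictions at hR'
  obtain ⟨hα₀, _, _, _, hβ, _, _, hL1, _, hres10, _, _, _, hres8⟩ := hR'
  have hLpos : 0 < c.L := by linarith
  have hexp := exp343_lt_two_of_restrictions c hR hY hη hj hscale
  have h44 := ineq344_of_inputs c hR hB hY hα₁ hη hj hscale hξ hξx h41a helem hP0 hP htri₁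
  have h45i := B12CondIIIJ.ineq345_inner (x := c.L ^ (j - 1) * η) hα₀.le hB hres10
  have h45 : T₄₅ < c.β * c.α₀ * (c.L ^ (j - 1) * η) ^ 2 := lt_of_lt_of_le h45a h45i
  have h46 := B12CondIIIJ.ineq346 htri₂ h44 h45
  have h45τ : Tτ < c.β * c.α₀ * (c.L ^ (j - 1) * η) ^ 2 := lt_of_lt_of_le h45τa h45i
  have h44τ := B12CondIIIJ.ineq344τ hτ0 hτ1 hD₁ h46 h45τ htri₃
  have h43τ := ineq343 hξ hξx helemτ hPτ0 hPτ hexp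
  have h47 := B12CondIIIJ.ineq347 hα₀.le hres10 htri₄ h44τ h43τ
  have hres7 : 1 + 7 * c.β ≤ c.L ^ 2 := by linarith
  exact B12CondIIIJ.ineq347_closes hLpos hα₀.le hβ.le (B12CondIIIJ.scale_nonneg j hLpos hη)
    (B12CondIIIJ.scale_le hLpos hη hj hscale) hres7 h47

end Literature.MathematicalPhysics.QuantumFieldTheory.Balaban1983to89.B12ExpSteps
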